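import Literature.Analysis.Calculus.ClassGermPi
import Literature.Analysis.Calculus.ClassFibreThree

/-!
# Glaeser on the torus `(S¹)^{3m}` with parameters — LOCAL FORM

**Theorem (local Glaeser–Schwarz for the Weyl group of `U(3)^m`).**  Let `f : (Fin m → Fin 3 → ℝ) × P → E` be `C^∞`, invariant
at every place `w` under the permutations of the three angles `x_w` and under their `2π`-shifts (i.e. `f` is a smooth class
function of the `m`-tuple of torus elements `diag(e^{i x_w k})_k` depending smoothly on a parameter `z ∈ P`).  Then for every
`x₀` there are `ε > 0` and a smooth `F : (Fin m → ℂ³) × P → E` — defined and `C^∞` EVERYWHERE — with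
`f (x, z) = F (cl x, z)` for ALL `x` whose place-wise class data `cl x = (w ↦ (Σ_k e^{ix_w k}, Σ_{j<k} …, Π_k e^{ix_w k}))`
lie within `ε` of `cl x₀`, and all `z`.

Assembly: the `m`-place germ model ★ `exists_contDiffOn_comp_classPi_of_stabilizer` at the base point `x₀` (for the germ
`y ↦ f (x₀ + y, ·)`, whose stabiliser symmetry comes from the symmetry and periodicity of `f`), a smooth cut-off
(★ `contDiff_smul_of_tsupport_subset`), and the fibre lemma ★ `exists_perm_int_near_of_classPi_near` (nearby class data come
from points near the `S₃^m ⋉ (2πℤ³)^m`-orbit of `x₀`, on which `f` is constant).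
[Glaeser1963Newton, Thm. II], [Schwarz1975, Thm. 1].
-/

noncomputable section

open Complex Set
open scoped ContDiff Topology

namespace Literature.Analysis.Calculus

/-! ## §1 Orbit invariance from place-wise symmetry and periodicity -/

/-- A function invariant, at every place, under slot permutations and `2πℤ³`-shifts is constant on `S₃^m ⋉ (2πℤ³)^m`-orbits. [cite: Schwarz1975, §1] -/
theorem apply_eq_of_forall_perm_shift {P E : Type*} {m : ℕ} (f : (Fin m → Fin 3 → ℝ) × P → E)
    (hsymm : ∀ (w : Fin m) (σ : Equiv.Perm (Fin 3)) (x : Fin m → Fin 3 → ℝ) (z : P), f (Function.update x w (x w ∘ (⇑σ)), z) = f (x, z))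
    (hper : ∀ (w : Fin m) (n : Fin 3 → ℤ) (x : Fin m → Fin 3 → ℝ) (z : P),
      f (Function.update x w (x w + fun k => 2 * Real.pi * (n k : ℝ)), z) = f (x, z))
    {x x' : Fin m → Fin 3 → ℝ} (σ : Fin m → Equiv.Perm (Fin 3)) (n : Fin m → Fin 3 → ℤ)
    (hx' : ∀ w k, x' w k = x w (σ w k) + 2 * Real.pi * (n w k : ℝ)) (z : P) : f (x', z) = f (x, z) := by
  classical
  suffices h : ∀ s : Finset (Fin m), f ((fun w => if w ∈ s then x' w else x w), z) = f (x, z) by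
    simpa using h Finset.univ
  intro s
  induction s using Finset.induction_on with
  | empty => simp
  | insert w s hw ih =>
    set xs : Fin m → Fin 3 → ℝ := fun w' => if w' ∈ s then x' w' else x w' with hxs
    have hins : (fun w' => if w' ∈ insert w s then x' w' else x w') = Function.update xs w (x' w) := by
      funext w'
      by_cases h : w' = w
      · subst h; simp
      · simp [h, hxs]
    rw [hins]
    have hxsw : xs w = x w := by simp [hxs, hw]
    have hx'w : x' w = (xs w ∘ (⇑(σ w))) + fun k => 2 * Real.pi * (n w k : ℝ) := by
      funext k
      rw [Pi.add_apply, Function.comp_apply, hxsw]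
      exact hx' w k
    rw [hx'w]
    have h := hper w (n w) (Function.update xs w (xs w ∘ (⇑(σ w)))) z
    rw [Function.update_self, Function.update_idem] at h
    rw [h, hsymm, ih]

/-! ## §2 The local theorem -/

universe u

variable {P : Type u} [NormedAddCommGroup P] [NormedSpace ℝ P] {E : Type u} [NormedAddCommGroup E] [NormedSpace ℝ E]

/-- **GLAESER ON THE TORUS WITH PARAMETERS — LOCAL FORM (`m` PLACES).**  `f : (Fin m → Fin 3 → ℝ) × P → E` smooth, invariant at every place under the slot
permutations and the `2πℤ³`-shifts of the angles; then for every `x₀` there are `ε > 0` and **`F : (Fin m → ℂ × ℂ × ℂ) × P → E`, `C^∞` everywhere, with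
`f (x, z) = F (cl x, z)` whenever `dist (cl x) (cl x₀) < ε`**, `cl x = (w ↦ (Σ_k e^{ix_w k}, Σ_{j<k} e^{ix_w j}e^{ix_w k}, Π_k e^{ix_w k}))`
(`P` finite-dimensional, `E` complete, one universe).  Germ model ★ `exists_contDiffOn_comp_classPi_of_stabilizer` + smooth cut-off + fibre lemma ★
`exists_perm_int_near_of_classPi_near`. [cite: Glaeser1963Newton, Thm. II] [cite: Schwarz1975, Thm. 1] [cite: Dieudonne1960, Ch. XVI §4] -/
theorem exists_contDiff_comp_classPi_near [FiniteDimensional ℝ P] [CompleteSpace E] {m : ℕ} (f : (Fin m → Fin 3 → ℝ) × P → E) (hf : ContDiff ℝ ∞ f)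
    (hsymm : ∀ (w : Fin m) (σ : Equiv.Perm (Fin 3)) (x : Fin m → Fin 3 → ℝ) (z : P), f (Function.update x w (x w ∘ (⇑σ)), z) = f (x, z))
    (hper : ∀ (w : Fin m) (n : Fin 3 → ℤ) (x : Fin m → Fin 3 → ℝ) (z : P),
      f (Function.update x w (x w + fun k => 2 * Real.pi * (n k : ℝ)), z) = f (x, z))
    (x₀ : Fin m → Fin 3 → ℝ) :
    ∃ ε > (0 : ℝ), ∃ F : (Fin m → ℂ × ℂ × ℂ) × P → E, ContDiff ℝ ∞ F ∧
      ∀ (x : Fin m → Fin 3 → ℝ) (z : P), dist (fun w => ((Complex.exp ((((x w 0 : ℝ)) : ℂ) * I) + Complex.exp ((((x w 1 : ℝ)) : ℂ) * I) + Complex.exp ((((x w 2 : ℝ)) : ℂ) * I),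
          Complex.exp ((((x w 0 : ℝ)) : ℂ) * I) * Complex.exp ((((x w 1 : ℝ)) : ℂ) * I) + Complex.exp ((((x w 0 : ℝ)) : ℂ) * I) * Complex.exp ((((x w 2 : ℝ)) : ℂ) * I) + Complex.exp ((((x w 1 : ℝ)) : ℂ) * I) * Complex.exp ((((x w 2 : ℝ)) : ℂ) * I),
          Complex.exp ((((x w 0 : ℝ)) : ℂ) * I) * Complex.exp ((((x w 1 : ℝ)) : ℂ) * I) * Complex.exp ((((x w 2 : ℝ)) : ℂ) * I)) : ℂ × ℂ × ℂ)) (fun w => ((Complex.exp ((((x₀ w 0 : ℝ)) : ℂ) * I) + Complex.exp ((((x₀ w 1 : ℝ)) : ℂ) * I) + Complex.exp ((((x₀ w 2 : ℝ)) : ℂ) * I),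
          Complex.exp ((((x₀ w 0 : ℝ)) : ℂ) * I) * Complex.exp ((((x₀ w 1 : ℝ)) : ℂ) * I) + Complex.exp ((((x₀ w 0 : ℝ)) : ℂ) * I) * Complex.exp ((((x₀ w 2 : ℝ)) : ℂ) * I) + Complex.exp ((((x₀ w 1 : ℝ)) : ℂ) * I) * Complex.exp ((((x₀ w 2 : ℝ)) : ℂ) * I),
          Complex.exp ((((x₀ w 0 : ℝ)) : ℂ) * I) * Complex.exp ((((x₀ w 1 : ℝ)) : ℂ) * I) * Complex.exp ((((x₀ w 2 : ℝ)) : ℂ) * I)) : ℂ × ℂ × ℂ)) < ε → f (x, z) = F ((fun w => ((Complex.exp ((((x w 0 : ℝ)) : ℂ) * I) + Complex.exp ((((x w 1 : ℝ)) : ℂ) * I) + Complex.exp ((((x w 2 : ℝ)) : ℂ) * I),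
          Complex.exp ((((x w 0 : ℝ)) : ℂ) * I) * Complex.exp ((((x w 1 : ℝ)) : ℂ) * I) + Complex.exp ((((x w 0 : ℝ)) : ℂ) * I) * Complex.exp ((((x w 2 : ℝ)) : ℂ) * I) + Complex.exp ((((x w 1 : ℝ)) : ℂ) * I) * Complex.exp ((((x w 2 : ℝ)) : ℂ) * I),
          Complex.exp ((((x w 0 : ℝ)) : ℂ) * I) * Complex.exp ((((x w 1 : ℝ)) : ℂ) * I) * Complex.exp ((((x w 2 : ℝ)) : ℂ) * I)) : ℂ × ℂ × ℂ)), z) := by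
  set cl : (Fin m → Fin 3 → ℝ) → (Fin m → ℂ × ℂ × ℂ) := fun x => (fun w => ((Complex.exp ((((x w 0 : ℝ)) : ℂ) * I) + Complex.exp ((((x w 1 : ℝ)) : ℂ) * I) + Complex.exp ((((x w 2 : ℝ)) : ℂ) * I),
          Complex.exp ((((x w 0 : ℝ)) : ℂ) * I) * Complex.exp ((((x w 1 : ℝ)) : ℂ) * I) + Complex.exp ((((x w 0 : ℝ)) : ℂ) * I) * Complex.exp ((((x w 2 : ℝ)) : ℂ) * I) + Complex.exp ((((x w 1 : ℝ)) : ℂ) * I) * Complex.exp ((((x w 2 : ℝ)) : ℂ) * I),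
          Complex.exp ((((x w 0 : ℝ)) : ℂ) * I) * Complex.exp ((((x w 1 : ℝ)) : ℂ) * I) * Complex.exp ((((x w 2 : ℝ)) : ℂ) * I)) : ℂ × ℂ × ℂ)) with hcl
  show ∃ ε > (0 : ℝ), ∃ F : (Fin m → ℂ × ℂ × ℂ) × P → E, ContDiff ℝ ∞ F ∧ ∀ (x : Fin m → Fin 3 → ℝ) (z : P), dist (cl x) (cl x₀) < ε → f (x, z) = F (cl x, z)
  rcases isEmpty_or_nonempty P with hP | hP
  · exact ⟨1, one_pos, fun _ => 0, contDiff_const, fun x z => isEmptyElim z⟩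
  obtain ⟨z₀⟩ := hP
  -- (1) the germ at `x₀`
  set g : (Fin m → Fin 3 → ℝ) × P → E := fun q => f (x₀ + q.1, q.2) with hg
  have hgs : ContDiff ℝ ∞ g := hf.comp ((contDiff_const.add contDiff_fst).prodMk contDiff_snd)
  have hstab : ∀ (w : Fin m) (σ : Equiv.Perm (Fin 3)), (∀ k, Complex.exp ((x₀ w (σ k) : ℂ) * I) = Complex.exp ((x₀ w k : ℂ) * I)) →
      ∀ (y : Fin m → Fin 3 → ℝ) (z : P), g (Function.update y w (y w ∘ (⇑σ)), z) = g (y, z) := by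
    intro w σ hσ y z
    have hn : ∀ k, ∃ n : ℤ, x₀ w (σ k) = x₀ w k + 2 * Real.pi * n := fun k => exists_int_of_cexp_mul_I_eq (hσ k).symm
    choose n hn using hn
    set X : Fin m → Fin 3 → ℝ := x₀ + y with hX
    have key : x₀ + Function.update y w (y w ∘ (⇑σ)) =
        Function.update (Function.update X w (X w ∘ (⇑σ))) w ((Function.update X w (X w ∘ (⇑σ))) w + fun k => 2 * Real.pi * ((-n k : ℤ) : ℝ)) := by
      rw [Function.update_self, Function.update_idem]
      funext w' k
      by_cases hw : w' = w
      · subst hw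
        simp only [Pi.add_apply, Function.update_self, Function.comp_apply, hX]
        have := hn k
        push_cast
        linarith
      · simp only [Pi.add_apply, Function.update_of_ne hw, hX]
    simp only [hg]
    rw [key, hper, hsymm]
  obtain ⟨W, hWo, F₀, hF₀, δ, hδ, hgerm⟩ := exists_contDiffOn_comp_classPi_of_stabilizer m x₀ g hgs hstab
  have hclS : ∀ y : Fin m → Fin 3 → ℝ, (fun w => ((Complex.exp ((((x₀ w 0 + y w 0 : ℝ)) : ℂ) * I) + Complex.exp ((((x₀ w 1 + y w 1 : ℝ)) : ℂ) * I) + Complex.exp ((((x₀ w 2 + y w 2 : ℝ)) : ℂ) * I),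
          Complex.exp ((((x₀ w 0 + y w 0 : ℝ)) : ℂ) * I) * Complex.exp ((((x₀ w 1 + y w 1 : ℝ)) : ℂ) * I) + Complex.exp ((((x₀ w 0 + y w 0 : ℝ)) : ℂ) * I) * Complex.exp ((((x₀ w 2 + y w 2 : ℝ)) : ℂ) * I) + Complex.exp ((((x₀ w 1 + y w 1 : ℝ)) : ℂ) * I) * Complex.exp ((((x₀ w 2 + y w 2 : ℝ)) : ℂ) * I),
          Complex.exp ((((x₀ w 0 + y w 0 : ℝ)) : ℂ) * I) * Complex.exp ((((x₀ w 1 + y w 1 : ℝ)) : ℂ) * I) * Complex.exp ((((x₀ w 2 + y w 2 : ℝ)) : ℂ) * I)) : ℂ × ℂ × ℂ)) = cl (x₀ + y) := fun y => rfl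
  -- (2) the cut-off
  have hc : cl x₀ ∈ W := by
    have h := (hgerm 0 (by simpa using hδ) z₀).1
    rw [hclS, add_zero] at h
    exact h
  obtain ⟨r, hr, hball⟩ := Metric.isOpen_iff.1 hWo (cl x₀) hc
  let χ : ContDiffBump (cl x₀) := ⟨r / 4, r / 2, by positivity, by linarith⟩
  have hχ1 : ∀ sc ∈ Metric.ball (cl x₀) (r / 4), (χ : (Fin m → ℂ × ℂ × ℂ) → ℝ) sc = 1 :=
    fun sc h => χ.one_of_mem_closedBall (Metric.ball_subset_closedBall h)
  have hχsupp : tsupport (χ : (Fin m → ℂ × ℂ × ℂ) → ℝ) ⊆ W := by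
    rw [χ.tsupport_eq]
    exact (Metric.closedBall_subset_ball (by show r / 2 < r; linarith)).trans hball
  set F : (Fin m → ℂ × ℂ × ℂ) × P → E := fun q => (χ : (Fin m → ℂ × ℂ × ℂ) → ℝ) q.1 • F₀ q with hF
  have hFs : ContDiff ℝ ∞ F := by
    refine contDiff_smul_of_tsupport_subset (s := (Prod.fst : (Fin m → ℂ × ℂ × ℂ) × P → (Fin m → ℂ × ℂ × ℂ)) ⁻¹' W) (hWo.preimage continuous_fst)
      (χ.contDiff.comp contDiff_fst) ?_ (by rwa [← Set.prod_univ])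
    intro q hq
    have hsub : tsupport ((χ : (Fin m → ℂ × ℂ × ℂ) → ℝ) ∘ Prod.fst : (Fin m → ℂ × ℂ × ℂ) × P → ℝ) ⊆ Prod.fst ⁻¹' tsupport (χ : (Fin m → ℂ × ℂ × ℂ) → ℝ) :=
      closure_minimal (fun q' (hq' : q' ∈ Function.support ((χ : (Fin m → ℂ × ℂ × ℂ) → ℝ) ∘ Prod.fst)) =>
        (subset_closure hq' : q'.1 ∈ tsupport (χ : (Fin m → ℂ × ℂ × ℂ) → ℝ))) ((isClosed_tsupport _).preimage continuous_fst)
    exact hχsupp (hsub hq)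
  -- (3) `δ'`: the germ radius, shrunk so that the class data stay in the ball where `χ = 1`
  have hSc : Continuous fun y : Fin m → Fin 3 → ℝ => (fun w => ((Complex.exp ((((x₀ w 0 + y w 0 : ℝ)) : ℂ) * I) + Complex.exp ((((x₀ w 1 + y w 1 : ℝ)) : ℂ) * I) + Complex.exp ((((x₀ w 2 + y w 2 : ℝ)) : ℂ) * I),
          Complex.exp ((((x₀ w 0 + y w 0 : ℝ)) : ℂ) * I) * Complex.exp ((((x₀ w 1 + y w 1 : ℝ)) : ℂ) * I) + Complex.exp ((((x₀ w 0 + y w 0 : ℝ)) : ℂ) * I) * Complex.exp ((((x₀ w 2 + y w 2 : ℝ)) : ℂ) * I) + Complex.exp ((((x₀ w 1 + y w 1 : ℝ)) : ℂ) * I) * Complex.exp ((((x₀ w 2 + y w 2 : ℝ)) : ℂ) * I),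
          Complex.exp ((((x₀ w 0 + y w 0 : ℝ)) : ℂ) * I) * Complex.exp ((((x₀ w 1 + y w 1 : ℝ)) : ℂ) * I) * Complex.exp ((((x₀ w 2 + y w 2 : ℝ)) : ℂ) * I)) : ℂ × ℂ × ℂ)) := continuous_classPi x₀
  have N : (fun y : Fin m → Fin 3 → ℝ => cl (x₀ + y)) ⁻¹' Metric.ball (cl x₀) (r / 4) ∈ 𝓝 (0 : Fin m → Fin 3 → ℝ) := by
    refine hSc.continuousAt.preimage_mem_nhds (Metric.isOpen_ball.mem_nhds ?_)
    have hr4 : (0 : ℝ) < r / 4 := by positivity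
    show cl (x₀ + 0) ∈ Metric.ball (cl x₀) (r / 4)
    rw [add_zero]
    exact Metric.mem_ball_self hr4
  obtain ⟨δr, hδr, hballr⟩ := Metric.mem_nhds_iff.1 N
  -- (4) the fibre lemma
  obtain ⟨ε, hε, hfib⟩ := exists_perm_int_near_of_classPi_near x₀ (lt_min hδ hδr)
  refine ⟨ε, hε, F, hFs, fun x z hx => ?_⟩
  obtain ⟨σ, n, hnear⟩ := hfib x hx
  set x' : Fin m → Fin 3 → ℝ := fun w k => x w (σ w k) + 2 * Real.pi * (n w k : ℝ) with hx'
  set y : Fin m → Fin 3 → ℝ := x' - x₀ with hy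
  have hyδ : ‖y‖ < δ := lt_of_lt_of_le hnear (min_le_left _ _)
  have hyr : ‖y‖ < δr := lt_of_lt_of_le hnear (min_le_right _ _)
  have hxy : x₀ + y = x' := by rw [hy]; abel
  -- class data of `x'` and `x` coincide
  have hclx : cl x' = cl x := by
    funext w
    have hk : ∀ k, Complex.exp (((x' w k : ℝ) : ℂ) * I) = Complex.exp (((x w (σ w k) : ℝ) : ℂ) * I) := by
      intro k
      have e : x' w k = x w (σ w k) + 2 * Real.pi * (n w k : ℝ) := rfl
      rw [show x w (σ w k) = x' w k - 2 * Real.pi * (n w k : ℝ) by rw [e]; ring]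
      exact (cexp_sub_two_pi_mul_int_mul_I (x' w k) (n w k)).symm
    simp only [hcl]
    rw [hk 0, hk 1, hk 2]
    exact esymmTriple_comp_perm (fun k => Complex.exp (((x w k : ℝ) : ℂ) * I)) (σ w)
  -- `f` is constant on the orbit
  have hfx : f (x', z) = f (x, z) := apply_eq_of_forall_perm_shift f hsymm hper σ n (fun w k => rfl) z
  -- assemble
  obtain ⟨-, hge⟩ := hgerm y hyδ z
  have hball' : cl (x₀ + y) ∈ Metric.ball (cl x₀) (r / 4) := hballr (by rw [Metric.mem_ball, dist_zero_right]; exact hyr)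
  rw [hclS] at hge
  rw [hxy, hclx] at hge hball'
  rw [← hfx]
  show f (x', z) = (χ : (Fin m → ℂ × ℂ × ℂ) → ℝ) (cl x) • F₀ (cl x, z)
  rw [hχ1 _ hball', one_smul, hge]
  simp only [hg]
  rw [hxy]

end Literature.Analysis.Calculus

end
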